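import Summits.RiemannHypothesis.RiemannHypothesis.Theses.WeilPos
import Literature.NumberTheory.LFunctions.WeilExplicitProofs
import Literature.NumberTheory.LFunctions.WeilExplicitFormulaProofs
import Literature.NumberTheory.LFunctions.UniformWeilPositivityRH
import HarnessLib

/-!
# `WeilPos.WeilposSlackThesis` (stmt-RiemannHypothesis-18180) — SUMMIT EQUIVALENCE (restatement witness)

Landed from the crux strategist's r1 workfile `Cruxes/WeilposSlackThesis/SummitEquivalence.lean` §§1–2
(2026-08-17) so that the tribunal has an importable, gate-checked witness that the deciding crux of route
`route-RiemannHypothesis-WeilPos` is the summit restated, and that its conjunct split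
`WeilposSlackRungLog2 ∧ SlackResidualLog2` carries the whole summit in the residual.

* `slackThesis_iff_riemannHypothesis : WeilposSlackThesis ↔ Summit.RiemannHypothesis`
  (`→` is the route's own deciding theorem `closes`, i.e. W-MAG `ConeMagnification_proof` at weight `Λ`;
   `←` is the easy half of Weil's criterion `WeilPositivity.of_riemannHypothesis explicit_formula_holds`
   together with `−‖g‖₂² ≤ 0`);
* `slackThesis_iff_weilposThesis : WeilposSlackThesis ↔ WeilposThesis` (the exact face, Weil's criterion);
* `slackResidualLog2_iff_riemannHypothesis_of_rung : WeilposSlackRungLog2 → (SlackResidualLog2 ↔ RH)` and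
  `rung_and_residual_iff_riemannHypothesis : WeilposSlackRungLog2 ∧ SlackResidualLog2 ↔ RH`.

No `sorry`; axioms propext / Classical.choice / Quot.sound. [folklore]
-/

noncomputable section

-- the layout-mandated namespace repeats the summit name
set_option linter.dupNamespace false

namespace Summit.RiemannHypothesis.RiemannHypothesis.Theorems.WeilPosSlackThesisCriterion

open Summit.RiemannHypothesis.RiemannHypothesis.Theses.WeilPos
open Literature.NumberTheory.LFunctions MeasureTheory Set

/-- Under RH the unit-slack inequality holds for every test function (no support condition):
`0 ≤ Re W(g ⋆ g̃)` (easy half of Weil's criterion) and `−∫‖g‖² ≤ 0`. [folklore] -/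
theorem slack_of_riemannHypothesis (hRH : _root_.Summit.RiemannHypothesis) (g : ℝ → ℂ)
    (hg : IsWeilTest g) : -(∫ t, ‖g t‖ ^ 2) ≤ (weilQuadratic g).re := by
  have h0 : 0 ≤ (weilQuadratic g).re :=
    WeilPositivity.of_riemannHypothesis explicit_formula_holds hRH g hg
  have h1 : 0 ≤ ∫ t, ‖g t‖ ^ 2 := integral_nonneg fun t => by positivity
  linarith

/-- `C → S`: the crux implies the summit — the route's deciding theorem `closes` with its residual binder
discharged by the identity. [folklore] -/
theorem riemannHypothesis_of_slackThesis (hS : WeilposSlackThesis) : _root_.Summit.RiemannHypothesis :=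
  closes (fun g hg hs => hS _ (Real.log_pos one_lt_two) g hg hs) (fun _ => hS)

/-- `S → C`: the summit implies the crux. [folklore] -/
theorem slackThesis_of_riemannHypothesis (hRH : _root_.Summit.RiemannHypothesis) : WeilposSlackThesis :=
  fun _ _ g hg _ => slack_of_riemannHypothesis hRH g hg

/-- **Restatement witness**: `WeilposSlackThesis ↔ RiemannHypothesis`. [folklore] -/
theorem slackThesis_iff_riemannHypothesis : WeilposSlackThesis ↔ _root_.Summit.RiemannHypothesis :=
  ⟨riemannHypothesis_of_slackThesis, slackThesis_of_riemannHypothesis⟩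

/-- … equivalently the exact face `WeilposThesis` (Weil's criterion,
`riemannHypothesis_iff_forall_weilPositivityOn`). [folklore] -/
theorem slackThesis_iff_weilposThesis : WeilposSlackThesis ↔ WeilposThesis :=
  slackThesis_iff_riemannHypothesis.trans riemannHypothesis_iff_forall_weilPositivityOn

/-- The attacked conjunct (first slack rung, cutoff `log 2`) is an RH-corollary. [folklore] -/
theorem slackRungLog2_of_riemannHypothesis (hRH : _root_.Summit.RiemannHypothesis) : WeilposSlackRungLog2 :=
  fun g hg _ => slack_of_riemannHypothesis hRH g hg

/-- The declared residual is an RH-corollary. [folklore] -/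
theorem slackResidualLog2_of_riemannHypothesis (hRH : _root_.Summit.RiemannHypothesis) : SlackResidualLog2 :=
  fun _ => slackThesis_of_riemannHypothesis hRH

/-- GIVEN THE RUNG, the residual IS the summit (rule-N witness for the conjunct split). [folklore] -/
theorem slackResidualLog2_iff_riemannHypothesis_of_rung (hR : WeilposSlackRungLog2) :
    SlackResidualLog2 ↔ _root_.Summit.RiemannHypothesis :=
  ⟨fun hRes => closes hR hRes, slackResidualLog2_of_riemannHypothesis⟩

/-- The conjunction of the two load-bearing binders of `closes` is exactly the summit. [folklore] -/
theorem rung_and_residual_iff_riemannHypothesis :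
    (WeilposSlackRungLog2 ∧ SlackResidualLog2) ↔ _root_.Summit.RiemannHypothesis :=
  ⟨fun h => closes h.1 h.2,
    fun h => ⟨slackRungLog2_of_riemannHypothesis h, slackResidualLog2_of_riemannHypothesis h⟩⟩

end Summit.RiemannHypothesis.RiemannHypothesis.Theorems.WeilPosSlackThesisCriterion

end
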